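import Literature.AlgebraicGeometry.Frobenioids.CategoriesFactorization
import HarnessLib

/-!
# Frobenioids I, §0: formal facts about FSM-, FSMI-morphisms and FSMI-chains

Mochizuki, *The geometry of Frobenioids I: the general theory*, Kyushu J. Math. **62** (2008)
293–400, §0 "Categories", kurims text pp. 14, 17–18 [cite: MochizukiFrdI2008, §0 p.17]: the
vocabulary `IsFSM` (fiberwise-surjective monomorphism), `IsFSMI` (irreducible FSM-morphism) and
`IsFSMIChain φ n` ("`φ` is a composite of `n` FSMI-morphisms") of the landed `Categories.lean` /
`CategoriesFactorization.lean`.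

This file records the formal closure properties used (silently) in the proofs of [FrdI]
Prop. 1.14 (ii), (iii) (pp. 42–43): isomorphisms are FSM-morphisms; FSMI-morphisms and
FSMI-chains absorb isomorphisms on either side; a chain factors through its first member; the
composite of a chain is an FSM-morphism; if `ψ ∘ φ` is an FSM-morphism and `ψ` a monomorphism
then `φ` is an FSM-morphism. Everything is PROVED; nothing here is specific to Frobenioids.
-/

namespace Literature.AlgebraicGeometry.Frobenioids

open CategoryTheory

universe v u

variable {C : Type u} [Category.{v} C]

/-! ### FSM-morphisms -/

/-- An isomorphism is an FSM-morphism. [cite: MochizukiFrdI2008, §0 p.14] -/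
theorem IsFSM.of_isIso {A B : C} (e : A ⟶ B) [IsIso e] : IsFSM e :=
  ⟨fun _ γ => ⟨_, γ ≫ inv e, 𝟙 _, by simp⟩, inferInstance⟩

/-- If `ψ ∘ φ` is an FSM-morphism and `ψ` is a monomorphism, then `φ` is an FSM-morphism
("it follows formally", FrdI p. 42). [cite: MochizukiFrdI2008, §0 p.14] -/
theorem IsFSM.of_comp_mono {A B B' : C} {φ : A ⟶ B} {ψ : B ⟶ B'} (h : IsFSM (φ ≫ ψ)) [Mono ψ] :
    IsFSM φ := by
  refine ⟨fun Z γ => ?_, ?_⟩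
  · obtain ⟨W, δ₁, δ₂, hδ⟩ := h.1 (γ ≫ ψ)
    exact ⟨W, δ₁, δ₂, (cancel_mono ψ).mp (by simpa only [Category.assoc] using hδ)⟩
  · haveI := h.2
    exact mono_of_mono φ ψ

/-! ### FSMI-morphisms and isomorphisms -/

/-- FSMI-morphisms are stable under post-composition with isomorphisms.
[cite: MochizukiFrdI2008, §0 p.17] -/
theorem IsFSMI.comp_iso {A B B' : C} {f : A ⟶ B} (hf : IsFSMI f) (e : B ≅ B') :
    IsFSMI (f ≫ e.hom) := by
  haveI := hf.1.2
  refine ⟨⟨fun Z γ => ?_, mono_comp _ _⟩, fun h => hf.2.1 ?_, fun X b a hba => ?_⟩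
  · obtain ⟨W, δ₁, δ₂, h⟩ := hf.1.1 (γ ≫ e.inv)
    exact ⟨W, δ₁, δ₂, by rw [← Category.assoc, h]; simp only [Category.assoc, e.inv_hom_id,
      Category.comp_id]⟩
  · haveI := h
    have : f = (f ≫ e.hom) ≫ e.inv := by rw [Category.assoc, e.hom_inv_id, Category.comp_id]
    rw [this]
    infer_instance
  · rcases hf.2.2 b (a ≫ e.inv) (by rw [← Category.assoc, hba, Category.assoc, e.hom_inv_id,
      Category.comp_id]) with ha | hb
    · left
      haveI := ha
      have : a = (a ≫ e.inv) ≫ e.hom := by rw [Category.assoc, e.inv_hom_id, Category.comp_id]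
      rw [this]
      infer_instance
    · exact Or.inr hb

/-- FSMI-morphisms are stable under pre-composition with isomorphisms.
[cite: MochizukiFrdI2008, §0 p.17] -/
theorem IsFSMI.iso_comp {A' A B : C} {f : A ⟶ B} (hf : IsFSMI f) (e : A' ≅ A) :
    IsFSMI (e.hom ≫ f) := by
  haveI := hf.1.2
  refine ⟨⟨fun Z γ => ?_, mono_comp _ _⟩, fun h => hf.2.1 ?_, fun X b a hba => ?_⟩
  · obtain ⟨W, δ₁, δ₂, h⟩ := hf.1.1 γ
    exact ⟨W, δ₁ ≫ e.inv, δ₂, by simpa only [Category.assoc, e.inv_hom_id_assoc] using h⟩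
  · haveI := h
    have : f = e.inv ≫ (e.hom ≫ f) := by rw [e.inv_hom_id_assoc]
    rw [this]
    infer_instance
  · rcases hf.2.2 (e.inv ≫ b) a (by rw [Category.assoc, hba, e.inv_hom_id_assoc]) with ha | hb
    · exact Or.inl ha
    · right
      haveI := hb
      have : b = e.hom ≫ (e.inv ≫ b) := by rw [e.hom_inv_id_assoc]
      rw [this]
      infer_instance

/-! ### FSMI-chains -/

/-- A chain of FSMI-morphisms `φₙ ∘ ⋯ ∘ φ₁` begins with an FSMI-morphism `φ₁` through which it
factors. [cite: MochizukiFrdI2008, §0 p.17] -/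
theorem IsFSMIChain.exists_fac {A B : C} {φ : A ⟶ B} {n : ℕ} (h : IsFSMIChain φ n) :
    ∃ (X : C) (ψ : A ⟶ X) (χ : X ⟶ B), IsFSMI ψ ∧ ψ ≫ χ = φ := by
  cases h with
  | single φ hφ => exact ⟨B, φ, 𝟙 B, hφ, Category.comp_id φ⟩
  | cons ψ χ n hψ _ => exact ⟨_, ψ, χ, hψ, rfl⟩

/-- The composite of a chain of FSMI-morphisms is an FSM-morphism ("every composite of
FSM-morphisms is again an FSM-morphism", p. 14). [cite: MochizukiFrdI2008, §0 p.14] -/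
theorem IsFSMIChain.isFSM {A B : C} {φ : A ⟶ B} {n : ℕ} (h : IsFSMIChain φ n) : IsFSM φ := by
  induction h with
  | single φ hφ => exact hφ.1
  | cons ψ χ n hψ _ ih => exact hψ.1.comp ih

/-- FSMI-chains absorb an isomorphism in front. [cite: MochizukiFrdI2008, §0 p.17] -/
theorem IsFSMIChain.iso_comp {A' A B : C} {φ : A ⟶ B} {n : ℕ} (h : IsFSMIChain φ n)
    (e : A' ≅ A) : IsFSMIChain (e.hom ≫ φ) n := by
  cases h with
  | single φ hφ => exact IsFSMIChain.single _ (hφ.iso_comp e)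
  | cons ψ χ n hψ hχ =>
    rw [← Category.assoc]
    exact IsFSMIChain.cons _ _ n (hψ.iso_comp e) hχ

/-- FSMI-chains absorb an isomorphism at the end. [cite: MochizukiFrdI2008, §0 p.17] -/
theorem IsFSMIChain.comp_iso {A B B' : C} {φ : A ⟶ B} {n : ℕ} (h : IsFSMIChain φ n)
    (e : B ≅ B') : IsFSMIChain (φ ≫ e.hom) n := by
  induction h with
  | single φ hφ => exact IsFSMIChain.single _ (hφ.comp_iso e)
  | cons ψ χ n hψ _ ih =>
    rw [Category.assoc]
    exact IsFSMIChain.cons _ _ n hψ (ih e)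

end Literature.AlgebraicGeometry.Frobenioids
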